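import Mathlib
import Literature.NumberTheory.Transcendental.Associators
import HarnessLib

/-!
# Associators II: first steps of Furusho's "pentagon ⇒ hexagons" [Furusho2010]

Proofs file accompanying `Associators.lean` (which states the named fact
`furusho_pentagon_hexagon` = [Furusho2010, Thm 1]). Following the printed proof
([Furusho2010, §2]; simplified account [BarnatanDancso2011, §3–4]) bottom-up, this file provides:

1. `NCSeries.wordsOfLength`, `NCSeries.wordsLE`, `NCSeries.evalTrunc_eq_sum_wordsLE` — the
   weight-truncated substitution as a sum over words; `NCSeries.truncIdeal α R N` — the two-sided
   ideal of series vanishing in weight `≤ N`, so that `NCSeries α R ⧸ truncIdeal α R N` is the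
   truncated free algebra `R⟨X_a⟩/(deg > N)` (`NCSeries.mk_eq_mk_iff`).
2. `DrinfeldKohnoTrunc.Compatible.lift` — the universal property of the truncated Drinfeld–Kohno
   algebra: images of the `t_ij` satisfying the defining relations and `(N+1)`-nilpotency extend
   to an algebra morphism.
3. `NCSeries.qLab`, `NCSeries.projQ` — the projection `q : U𝔞₄ → k⟨⟨X, Y⟩⟩`,
   `t₁₂, t₃₄ ↦ X`, `t₂₃, t₁₄ ↦ Y`, `t₁₃, t₂₄ ↦ -X-Y` of [BarnatanDancso2011, proof of Lemma 4.1]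
   (= the composite `U𝔞₄ → U𝔓₅ → U𝔉₂` of [Furusho2010, Lemmas 5–6]), truncation by truncation, and
   the image of the pentagon under it (`NCSeries.DrinfeldPentagon.projQ_pentagon`).
4. Degenerate evaluations of group-like series: `NCSeries.count_shuffleWord_replicate` (`0ⁱ ш 1ʲ`
   lists each word with `i` zeros and `j` ones once), `NCSeries.IsGroupLike.sum_filter_count_eq`,
   `NCSeries.IsGroupLike.apply_replicate_eq_zero` and
   `NCSeries.IsGroupLike.evalTrunc_eq_one_of_commute`: `φ(A, B) = 1` whenever `AB = BA` and
   `c_X(φ) = c_Y(φ) = 0` (the abelianisation of a commutator-group-like series is `1`,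
   [Furusho2010, proof of Lemma 5]).
5. **[Furusho2010, Lemma 6]** `NCSeries.DrinfeldPentagon.two_cycle`: a group-like solution of
   Drinfeld's pentagon equation over a commutative `ℚ`-algebra satisfies the 2-cycle relation
   `φ(X,Y) φ(Y,X) = 1 = φ(Y,X) φ(X,Y)` (`NCSeries.swapXY φ = φ(Y,X)`).

These are the first two steps (commutator-group-likeness being `DrinfeldPentagon.apply_letter_eq_zero`
in `Associators.lean`) of the printed proof of [Furusho2010, Thm 1]; the remaining steps (Lemma 7,
Thm 3, Lemmas 8–9, Thm 10) are not formalised here.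

## References

* H. Furusho, *Pentagon and hexagon equations*, Ann. of Math. 171 (2010), 545–556, §2,
  Lemmas 5, 6. [Furusho2010]
* D. Bar-Natan, Z. Dancso, *Pentagon and hexagon equations following Furusho*, Proc. AMS 140
  (2012), 1243–1250 (arXiv:1010.0754), Lemma 4.1. [BarnatanDancso2011]
-/

noncomputable section

open scoped BigOperators

namespace Literature.NumberTheory.Transcendental

universe u v

namespace NCSeries

variable {α : Type u} {R : Type v}

/-! ## 1. Words of bounded length -/

section Words

variable (α) [Fintype α]

/-- The words of length exactly `n` over a finite alphabet, as a finset of lists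
(`List.ofFn f`, `f : Fin n → α`). [folklore] -/
def wordsOfLength (n : ℕ) : Finset (List α) :=
  (Finset.univ : Finset (Fin n → α)).map ⟨List.ofFn, List.ofFn_injective⟩

variable {α}

/-- `w ∈ wordsOfLength α n ↔ |w| = n`. [folklore] -/
@[simp] theorem mem_wordsOfLength {n : ℕ} {w : List α} : w ∈ wordsOfLength α n ↔ w.length = n := by
  constructor
  · intro h
    obtain ⟨f, -, rfl⟩ := Finset.mem_map.mp h
    exact List.length_ofFn
  · rintro rfl
    exact Finset.mem_map.mpr ⟨w.get, Finset.mem_univ _, List.ofFn_get w⟩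

/-- A sum over `Fin n → α` is a sum over the words of length `n`. [folklore] -/
theorem sum_fin_eq_sum_wordsOfLength {M : Type*} [AddCommMonoid M] (n : ℕ) (F : List α → M) :
    ∑ f : Fin n → α, F (List.ofFn f) = ∑ w ∈ wordsOfLength α n, F w := by
  rw [wordsOfLength, Finset.sum_map]
  rfl

variable [DecidableEq α]

variable (α) in
/-- The words of length `≤ N` over a finite alphabet. [folklore] -/
def wordsLE (N : ℕ) : Finset (List α) := (Finset.range (N + 1)).biUnion (wordsOfLength α)

/-- `w ∈ wordsLE α N ↔ |w| ≤ N`. [folklore] -/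
@[simp] theorem mem_wordsLE {N : ℕ} {w : List α} : w ∈ wordsLE α N ↔ w.length ≤ N := by
  simp only [wordsLE, Finset.mem_biUnion, Finset.mem_range, mem_wordsOfLength]
  constructor
  · rintro ⟨n, hn, rfl⟩; omega
  · intro h; exact ⟨w.length, by omega, rfl⟩

/-- **The truncated substitution as a sum over words**:
`evalTrunc N v φ = Σ_{|w| ≤ N} c_w(φ) · v(w)`. [folklore] -/
theorem evalTrunc_eq_sum_wordsLE [CommSemiring R] {A : Type*} [Semiring A] [Algebra R A] (N : ℕ)
    (v : α → A) (φ : NCSeries α R) :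
    evalTrunc N v φ = ∑ w ∈ wordsLE α N, φ w • (w.map v).prod := by
  unfold evalTrunc wordsLE
  rw [Finset.sum_biUnion]
  · exact Finset.sum_congr rfl fun n _ =>
      sum_fin_eq_sum_wordsOfLength n (fun w => φ w • (w.map v).prod)
  · intro m _ n _ hmn
    rw [Function.onFun, Finset.disjoint_left]
    intro w hm hn
    rw [mem_wordsOfLength] at hm hn
    exact hmn (hm.symm.trans hn)

end Words

/-! ## 2. Truncation ideals and the truncated free algebra -/

section Trunc

variable [Semiring R]

/-- A product of series without constant term vanishes on every word shorter than the number of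
factors. [folklore] -/
theorem list_prod_apply_eq_zero (L : List (NCSeries α R)) (hL : ∀ S ∈ L, S [] = 0) :
    ∀ w : List α, w.length < L.length → L.prod w = 0 := by
  induction L with
  | nil => intro w hw; simp at hw
  | cons S L ih =>
    intro w hw
    rw [List.prod_cons, mul_apply]
    refine Finset.sum_eq_zero ?_
    rintro ⟨u, u'⟩ hp
    rw [mem_splits] at hp
    dsimp only
    cases u with
    | nil =>
      rw [hL S (by simp), zero_mul]
    | cons a u =>
      have hu' : u'.length < L.length := by
        rw [← hp] at hw
        simp only [List.cons_append, List.length_cons, List.length_append] at hw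
        omega
      rw [ih (fun T hT => hL T (by simp [hT])) u' hu', mul_zero]

variable (α R) in
/-- The **truncation ideal** of weight `N`: the series vanishing on all words of length `≤ N`
(series `≡ 0 mod deg N + 1`). It is a two-sided ideal, and the quotient
`NCSeries α R ⧸ truncIdeal α R N` is the truncated free algebra `R⟨X_a : a ∈ α⟩/(deg > N)`.
[folklore] -/
def truncIdeal (N : ℕ) : Ideal (NCSeries α R) where
  carrier := {φ | ∀ w : List α, w.length ≤ N → φ w = 0}
  add_mem' {φ ψ} hφ hψ w hw := by simp [hφ w hw, hψ w hw]
  zero_mem' _ _ := rfl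
  smul_mem' ψ φ hφ w hw := by
    change (ψ * φ) w = 0
    rw [mul_apply]
    refine Finset.sum_eq_zero ?_
    rintro ⟨u, u'⟩ hp
    rw [mem_splits] at hp
    dsimp only
    have hu' : u'.length ≤ N := by rw [← hp] at hw; simp at hw; omega
    rw [hφ u' hu', mul_zero]

/-- Membership in the truncation ideal. [folklore] -/
theorem mem_truncIdeal {N : ℕ} {φ : NCSeries α R} :
    φ ∈ truncIdeal α R N ↔ ∀ w : List α, w.length ≤ N → φ w = 0 := Iff.rfl

/-- The truncation ideal is two-sided. [folklore] -/
instance truncIdeal_isTwoSided (N : ℕ) : (truncIdeal α R N).IsTwoSided :=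
  ⟨fun {φ} ψ hφ w hw => by
    rw [mul_apply]
    refine Finset.sum_eq_zero ?_
    rintro ⟨u, u'⟩ hp
    rw [mem_splits] at hp
    dsimp only
    have hu : u.length ≤ N := by rw [← hp] at hw; simp at hw; omega
    rw [mem_truncIdeal.mp hφ u hu, zero_mul]⟩

end Trunc

section TruncRing

variable [Ring R]

/-- Two series have the same class modulo weight `> N` iff their coefficients agree in weight
`≤ N`. [folklore] -/
theorem mk_eq_mk_iff {N : ℕ} {φ ψ : NCSeries α R} :
    Ideal.Quotient.mk (truncIdeal α R N) φ = Ideal.Quotient.mk (truncIdeal α R N) ψ ↔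
      ∀ w : List α, w.length ≤ N → φ w = ψ w := by
  rw [Ideal.Quotient.eq, mem_truncIdeal]
  simp [sub_eq_zero]

/-- In the truncated algebra, every product of more than `N` series without constant term
vanishes. [folklore] -/
theorem mk_list_prod_eq_zero {N : ℕ} (L : List (NCSeries α R)) (hL : ∀ S ∈ L, S [] = 0)
    (hlen : N < L.length) : Ideal.Quotient.mk (truncIdeal α R N) L.prod = 0 := by
  rw [Ideal.Quotient.eq_zero_iff_mem, mem_truncIdeal]
  intro w hw
  exact list_prod_apply_eq_zero L hL w (by omega)

end TruncRing

end NCSeries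

/-! ## 3. The universal property of the truncated Drinfeld–Kohno algebra -/

namespace DrinfeldKohnoTrunc

variable {R : Type u} [CommRing R] {ι : Type v} {N : ℕ} {A : Type*} [Ring A] [Algebra R A]

variable (N) in
/-- A family `f i j` of elements of an `R`-algebra `A` is **compatible** with the truncated
Drinfeld–Kohno relations: `f i i = 0`, `f i j = f j i`, the infinitesimal braid relations, locality,
and every product of `N + 1` of them vanishes. [folklore] -/
structure Compatible (f : ι → ι → A) : Prop where
  /-- `f i i = 0` -/
  diag : ∀ i, f i i = 0
  /-- `f i j = f j i` -/
  symm : ∀ i j, f i j = f j i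
  /-- `[f_ij, f_ik + f_jk] = 0` for `i, j, k` distinct -/
  fourTerm : ∀ i j k, i ≠ j → j ≠ k → i ≠ k → f i j * (f i k + f j k) = (f i k + f j k) * f i j
  /-- `[f_ij, f_kl] = 0` for `i, j, k, l` distinct -/
  locality : ∀ i j k l, i ≠ j → i ≠ k → i ≠ l → j ≠ k → j ≠ l → k ≠ l →
    f i j * f k l = f k l * f i j
  /-- products of `N + 1` values vanish -/
  trunc : ∀ g : Fin (N + 1) → ι × ι, (List.ofFn fun r => f (g r).1 (g r).2).prod = 0

namespace Compatible

variable {f : ι → ι → A}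

/-- A compatible family respects the defining relations `DrinfeldKohno.Rel`. [folklore] -/
theorem lift_rel (h : Compatible N f) {a b : FreeAlgebra R (ι × ι)}
    (hab : DrinfeldKohno.Rel R ι N a b) :
    FreeAlgebra.lift R (fun p : ι × ι => f p.1 p.2) a =
      FreeAlgebra.lift R (fun p : ι × ι => f p.1 p.2) b := by
  cases hab with
  | diag i => simpa using h.diag i
  | symm i j => simpa using h.symm i j
  | fourTerm i j k hij hjk hik => simpa [map_mul, map_add] using h.fourTerm i j k hij hjk hik
  | locality i j k l h1 h2 h3 h4 h5 h6 =>
    simpa [map_mul] using h.locality i j k l h1 h2 h3 h4 h5 h6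
  | trunc g =>
    rw [map_list_prod, map_zero, List.map_ofFn]
    simpa [Function.comp_def] using h.trunc g

/-- **Universal property**: a compatible family `f` extends to an `R`-algebra morphism
`DrinfeldKohnoTrunc R ι N → A`, `t i j ↦ f i j`. [folklore] -/
def lift (h : Compatible N f) : DrinfeldKohnoTrunc R ι N →ₐ[R] A :=
  RingQuot.liftAlgHom R
    ⟨FreeAlgebra.lift R (fun p : ι × ι => f p.1 p.2), fun _ _ hab => h.lift_rel hab⟩

/-- `lift h (t i j) = f i j`. [folklore] -/
@[simp] theorem lift_t (h : Compatible N f) (i j : ι) : h.lift (t R N i j) = f i j :=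
  (RingQuot.liftAlgHom_mkAlgHom_apply R (FreeAlgebra.lift R fun p : ι × ι => f p.1 p.2) _ _).trans
    (FreeAlgebra.lift_ι_apply _ _)

end Compatible

end DrinfeldKohnoTrunc

/-! ## 4. The projection `q : U𝔞₄ → k⟨⟨X, Y⟩⟩` -/

namespace NCSeries

section ProjQ

variable {k : Type u} [CommRing k]

/-- Bar-Natan–Dancso's labels `q(t_ij)` on strands `{0,1,2,3}` for a pair `(P, Q)`:
`t₀₁, t₂₃ ↦ P`, `t₁₂, t₀₃ ↦ Q`, `t₀₂, t₁₃ ↦ -P - Q`, `t_ii ↦ 0` (indices as naturals; values `≥ 4`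
unused). For `(P, Q) = (X, Y)` this is the map `q` of [BarnatanDancso2011, Lemma 4.1]
(`t₁₂ ↦ X, t₂₃ ↦ Y, t₁₃ ↦ -X-Y, t₁₄ ↦ Y, t₂₄ ↦ -X-Y, t₃₄ ↦ X` on strands `1..4`).
[cite: BarnatanDancso2011, Lemma 4.1] -/
def qLab {A : Type*} [Ring A] (P Q : A) : ℕ → ℕ → A
  | 0, 1 => P
  | 1, 0 => P
  | 2, 3 => P
  | 3, 2 => P
  | 1, 2 => Q
  | 2, 1 => Q
  | 0, 3 => Q
  | 3, 0 => Q
  | 0, 2 => -P - Q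
  | 2, 0 => -P - Q
  | 1, 3 => -P - Q
  | 3, 1 => -P - Q
  | _, _ => 0

section QLab

variable {A : Type*} [Ring A] (P Q : A)

/-- `q(t_ii) = 0`. [folklore] -/
theorem qLab_diag (i : Fin 4) : qLab P Q i i = 0 := by
  fin_cases i <;> rfl

/-- `q(t_ij) = q(t_ji)`. [folklore] -/
theorem qLab_symm (i j : Fin 4) : qLab P Q i j = qLab P Q j i := by
  fin_cases i <;> fin_cases j <;> rfl

/-- On every triangle the three labels sum to zero: `q(t_ij) + q(t_ik) + q(t_jk) = 0`. [folklore] -/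
theorem qLab_triangle (i j l : Fin 4) (hij : i ≠ j) (hjl : j ≠ l) (hil : i ≠ l) :
    qLab P Q i j + qLab P Q i l + qLab P Q j l = 0 := by
  fin_cases i <;> fin_cases j <;> fin_cases l <;> first
    | exact absurd rfl hij | exact absurd rfl hjl | exact absurd rfl hil
    | (simp only [qLab]; abel)

/-- Opposite edges carry the same label: `q(t_ij) = q(t_kl)` for `{i,j,k,l} = {0,1,2,3}`.
[folklore] -/
theorem qLab_opposite (i j l m : Fin 4) (hij : i ≠ j) (hil : i ≠ l) (him : i ≠ m) (hjl : j ≠ l)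
    (hjm : j ≠ m) (hlm : l ≠ m) : qLab P Q i j = qLab P Q l m := by
  fin_cases i <;> fin_cases j <;> fin_cases l <;> fin_cases m <;> first
    | exact absurd rfl hij | exact absurd rfl hil | exact absurd rfl him | exact absurd rfl hjl
    | exact absurd rfl hjm | exact absurd rfl hlm | rfl

/-- The infinitesimal braid relations for the labels. [folklore] -/
theorem qLab_fourTerm (i j l : Fin 4) (hij : i ≠ j) (hjl : j ≠ l) (hil : i ≠ l) :
    qLab P Q i j * (qLab P Q i l + qLab P Q j l) = (qLab P Q i l + qLab P Q j l) * qLab P Q i j := by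
  have h : qLab P Q i l + qLab P Q j l = -qLab P Q i j := by
    rw [← sub_eq_zero, sub_neg_eq_add]
    have := qLab_triangle P Q i j l hij hjl hil
    rw [← this]; abel
  rw [h, mul_neg, neg_mul]

/-- All labels have the constant term of `P`, `Q`: if these vanish on a word then so does every
label. [folklore] -/
theorem qLab_apply_eq_zero {B : Type*} [AddCommGroup B] (π : A →+ B) (hP : π P = 0) (hQ : π Q = 0)
    (i j : ℕ) : π (qLab P Q i j) = 0 := by
  unfold qLab
  split <;> simp [hP, hQ, map_sub, map_neg]

end QLab

variable (k) in
/-- The family `mk ∘ q` with values in the truncated free algebra is compatible with the truncated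
Drinfeld–Kohno relations, for any `P, Q ∈ k⟨⟨X,Y⟩⟩` without constant term. [folklore] -/
theorem qLab_compatible (N : ℕ) (P Q : NCSeries Bool k) (hP : P [] = 0) (hQ : Q [] = 0) :
    DrinfeldKohnoTrunc.Compatible N
      (fun i j : Fin 4 => Ideal.Quotient.mk (truncIdeal Bool k N) (qLab P Q i j)) where
  diag i := by simp [qLab_diag]
  symm i j := by rw [qLab_symm]
  fourTerm i j l hij hjl hil := by
    simp only [← map_add, ← map_mul, qLab_fourTerm P Q i j l hij hjl hil]
  locality i j l m h1 h2 h3 h4 h5 h6 := by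
    rw [qLab_opposite P Q i j l m h1 h2 h3 h4 h5 h6]
  trunc g := by
    have e : (List.ofFn fun r =>
        Ideal.Quotient.mk (truncIdeal Bool k N) (qLab P Q ((g r).1 : ℕ) ((g r).2 : ℕ))) =
        (List.ofFn fun r => qLab P Q ((g r).1 : ℕ) ((g r).2 : ℕ)).map
          (Ideal.Quotient.mk (truncIdeal Bool k N)) := by
      rw [List.map_ofFn]; rfl
    rw [e, ← map_list_prod]
    refine mk_list_prod_eq_zero _ (fun S hS => ?_) (by simp)
    rw [List.mem_ofFn] at hS
    obtain ⟨r, rfl⟩ := hS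
    exact qLab_apply_eq_zero P Q (coeff (R := k) ([] : List Bool)).toAddMonoidHom hP hQ _ _

variable (k) in
/-- **The projection `q`** of [BarnatanDancso2011, Lemma 4.1] / [Furusho2010, Lemmas 5–6], in
weight truncation `N`, for labels `(P, Q)`: the `k`-algebra morphism
`U𝔞₄ ⊗ k/(deg > N) → k⟨⟨X,Y⟩⟩/(deg > N)` with `t₀₁, t₂₃ ↦ P`, `t₁₂, t₀₃ ↦ Q`, `t₀₂, t₁₃ ↦ -P-Q`.
[cite: BarnatanDancso2011, Lemma 4.1] -/
def projQ (N : ℕ) (P Q : NCSeries Bool k) (hP : P [] = 0) (hQ : Q [] = 0) :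
    DrinfeldKohnoTrunc k (Fin 4) N →ₐ[k] (NCSeries Bool k ⧸ truncIdeal Bool k N) :=
  (qLab_compatible k N P Q hP hQ).lift

/-- `q(t_ij) = [qLab P Q i j]`. [folklore] -/
@[simp] theorem projQ_t (N : ℕ) (P Q : NCSeries Bool k) (hP : P [] = 0) (hQ : Q [] = 0)
    (i j : Fin 4) :
    projQ k N P Q hP hQ (t₄ k N i j) = Ideal.Quotient.mk (truncIdeal Bool k N) (qLab P Q i j) :=
  (qLab_compatible k N P Q hP hQ).lift_t i j

/-- Algebra maps commute with the two-letter substitution `bsub`. [folklore] -/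
theorem comp_bsub {A B : Type*} (F : A → B) (a b : A) : F ∘ bsub a b = bsub (F a) (F b) := by
  funext c; cases c <;> rfl

/-- `[φ(A, B)] = φ([A], [B])` in the truncated free algebra. [folklore] -/
theorem mk_evalTrunc (N : ℕ) (φ : NCSeries Bool k) (A B : NCSeries Bool k) :
    Ideal.Quotient.mk (truncIdeal Bool k N) (evalTrunc N (bsub A B) φ) =
      evalTrunc N (bsub (Ideal.Quotient.mk (truncIdeal Bool k N) A)
        (Ideal.Quotient.mk (truncIdeal Bool k N) B)) φ := by
  have h := algHom_evalTrunc (Ideal.Quotient.mkₐ k (truncIdeal Bool k N)) N (bsub A B) φ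
  rw [Ideal.Quotient.mkₐ_eq_mk] at h
  rw [h, comp_bsub]

/-- **The image of the pentagon under `q`** (labels `(P, Q)`): in `k⟨⟨X,Y⟩⟩/(deg > N)`,
`φ(P, -P) φ(-P, P) = φ(Q, P) φ(-Q, -Q) φ(P, Q)`. For `(P, Q) = (X, Y)` this is
`φ(X,-X) φ(-X,X) = φ(Y,X) φ(-Y,-Y) φ(X,Y)` [Furusho2010, proof of Lemma 6 via Lemma 5, (11)].
[cite: Furusho2010, Lemma 6] -/
theorem DrinfeldPentagon.projQ_pentagon {φ : NCSeries Bool k} (h : DrinfeldPentagon φ) (N : ℕ)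
    (P Q : NCSeries Bool k) (hP : P [] = 0) (hQ : Q [] = 0) :
    Ideal.Quotient.mk (truncIdeal Bool k N) (evalTrunc N (bsub P (-P)) φ) *
        Ideal.Quotient.mk (truncIdeal Bool k N) (evalTrunc N (bsub (-P) P) φ) =
      Ideal.Quotient.mk (truncIdeal Bool k N) (evalTrunc N (bsub Q P) φ) *
          Ideal.Quotient.mk (truncIdeal Bool k N) (evalTrunc N (bsub (-Q) (-Q)) φ) *
        Ideal.Quotient.mk (truncIdeal Bool k N) (evalTrunc N (bsub P Q) φ) := by
  have hp := congrArg (projQ k N P Q hP hQ) (h N)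
  simp only [map_mul, subst₂, algHom_evalTrunc, comp_bsub, map_add, projQ_t] at hp
  have e01 : (qLab P Q ((0 : Fin 4) : ℕ) ((1 : Fin 4) : ℕ)) = P := rfl
  have e12 : (qLab P Q ((1 : Fin 4) : ℕ) ((2 : Fin 4) : ℕ)) = Q := rfl
  have e13 : (qLab P Q ((1 : Fin 4) : ℕ) ((3 : Fin 4) : ℕ)) = -P - Q := rfl
  have e02 : (qLab P Q ((0 : Fin 4) : ℕ) ((2 : Fin 4) : ℕ)) = -P - Q := rfl
  have e23 : (qLab P Q ((2 : Fin 4) : ℕ) ((3 : Fin 4) : ℕ)) = P := rfl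
  rw [e01, e12, e13, e02, e23] at hp
  simp only [← map_add] at hp
  have a1 : Q + (-P - Q) = -P := by abel
  have a2 : -P - Q + Q = -P := by abel
  have a3 : P + (-P - Q) = -Q := by abel
  have a4 : -P - Q + P = -Q := by abel
  rw [a1, a2, a3, a4] at hp
  simpa only [← mk_evalTrunc] using hp

end ProjQ

/-! ## 5. Degenerate evaluations of group-like series -/

variable {α : Type u} {R : Type v}

section Counting

variable [DecidableEq α]

/-- Counting a cons in a list of conses. [folklore] -/
theorem count_cons_map_cons (c a : α) (w : List α) (L : List (List α)) :
    (L.map (List.cons a)).count (c :: w) = if c = a then L.count w else 0 := by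
  induction L with
  | nil => simp
  | cons l L ih =>
    rw [List.map_cons, List.count_cons, ih, List.count_cons]
    by_cases hca : c = a
    · subst hca
      simp
    · have hne : (a :: l == c :: w) = false := by
        rw [beq_eq_false_iff_ne]
        intro h
        exact hca (List.cons.inj h).1.symm
      simp [hca, hne]

/-- The empty word is not a cons. [folklore] -/
theorem count_nil_map_cons (a : α) (L : List (List α)) : (L.map (List.cons a)).count [] = 0 :=
  List.count_eq_zero.mpr (by simp)

end Counting

/-- `a ш aⁿ = (n + 1) · aⁿ⁺¹`. [folklore] -/
theorem shuffleWord_singleton_replicate (a : α) (n : ℕ) :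
    MZV.shuffleWord [a] (List.replicate n a) = List.replicate (n + 1) (List.replicate (n + 1) a) := by
  induction n with
  | zero => rfl
  | succ n ih =>
    show MZV.shuffleWord [a] (a :: List.replicate n a) = _
    rw [MZV.shuffleWord_cons_cons, MZV.shuffleWord_nil_left, ih, List.map_replicate]
    rfl

section CountingBool

/-- A binary word is `1ʲ` iff it has no `0` and `j` letters `1`. [folklore] -/
theorem eq_replicate_true_iff (u : List Bool) (j : ℕ) :
    u = List.replicate j true ↔ u.count false = 0 ∧ u.count true = j := by
  have hlen := List.count_not_add_count u true
  simp only [Bool.not_true] at hlen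
  rw [List.eq_replicate_iff, List.count_eq_zero]
  constructor
  · rintro ⟨hl, hall⟩
    have hf : false ∉ u := fun h => Bool.false_ne_true (hall false h)
    refine ⟨hf, ?_⟩
    have h0 : u.count false = 0 := List.count_eq_zero.mpr hf
    omega
  · rintro ⟨hf, hj⟩
    have h0 : u.count false = 0 := List.count_eq_zero.mpr hf
    refine ⟨by omega, fun b hb => ?_⟩
    cases b
    · exact absurd hb hf
    · rfl

/-- A binary word is `0ⁱ` iff it has `i` letters `0` and no `1`. [folklore] -/
theorem eq_replicate_false_iff (u : List Bool) (i : ℕ) :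
    u = List.replicate i false ↔ u.count false = i ∧ u.count true = 0 := by
  have hlen := List.count_not_add_count u true
  simp only [Bool.not_true] at hlen
  rw [List.eq_replicate_iff, List.count_eq_zero]
  constructor
  · rintro ⟨hl, hall⟩
    have ht : true ∉ u := fun h => Bool.false_ne_true (hall true h).symm
    refine ⟨?_, ht⟩
    have h0 : u.count true = 0 := List.count_eq_zero.mpr ht
    omega
  · rintro ⟨hi, ht⟩
    have h0 : u.count true = 0 := List.count_eq_zero.mpr ht
    refine ⟨by omega, fun b hb => ?_⟩
    cases b
    · rfl
    · exact absurd hb ht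

/-- **`0ⁱ ш 1ʲ` lists every binary word with `i` zeros and `j` ones exactly once** (shuffles of
words in disjoint alphabets have no multiplicity). [folklore] -/
theorem count_shuffleWord_replicate (w : List Bool) : ∀ i j : ℕ,
    (MZV.shuffleWord (List.replicate i false) (List.replicate j true)).count w =
      if w.count false = i ∧ w.count true = j then 1 else 0 := by
  induction w with
  | nil =>
    intro i j
    cases i with
    | zero =>
      rw [List.replicate_zero, MZV.shuffleWord_nil_left, List.count_singleton]
      have e : ((List.replicate j true == ([] : List Bool)) = true) ↔ j = 0 := by
        rw [beq_iff_eq, List.replicate_eq_nil_iff]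
      by_cases hj : j = 0
      · rw [if_pos (e.mpr hj), if_pos ⟨List.count_nil, by rw [List.count_nil, hj]⟩]
      · rw [if_neg (fun h => hj (e.mp h)),
          if_neg (fun h => hj (by rw [List.count_nil] at h; exact h.2.symm))]
    | succ i =>
      cases j with
      | zero =>
        rw [List.replicate_zero, MZV.shuffleWord_nil_right, List.count_singleton]
        rw [if_neg (fun h => by
            rw [beq_iff_eq, List.replicate_eq_nil_iff] at h; exact Nat.succ_ne_zero _ h),
          if_neg (fun h => by rw [List.count_nil] at h; exact Nat.succ_ne_zero _ h.1.symm)]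
      | succ j =>
        rw [List.replicate_succ, List.replicate_succ, MZV.shuffleWord_cons_cons, List.count_append,
          count_nil_map_cons, count_nil_map_cons,
          if_neg (fun h => by rw [List.count_nil] at h; exact Nat.succ_ne_zero _ h.1.symm)]
  | cons c w ih =>
    intro i j
    cases i with
    | zero =>
      rw [List.replicate_zero, MZV.shuffleWord_nil_left, List.count_singleton]
      by_cases hw : c :: w = List.replicate j true
      · rw [if_pos (by rw [hw]; exact beq_self_eq_true _), if_pos ((eq_replicate_true_iff _ _).mp hw)]
      · rw [if_neg (fun h => hw (beq_iff_eq.mp h).symm),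
          if_neg (fun h' => hw ((eq_replicate_true_iff _ _).mpr h'))]
    | succ i =>
      cases j with
      | zero =>
        rw [List.replicate_zero, MZV.shuffleWord_nil_right, List.count_singleton]
        by_cases hw : c :: w = List.replicate (i + 1) false
        · rw [if_pos (by rw [hw]; exact beq_self_eq_true _),
            if_pos ((eq_replicate_false_iff _ _).mp hw)]
        · rw [if_neg (fun h => hw (beq_iff_eq.mp h).symm),
            if_neg (fun h' => hw ((eq_replicate_false_iff _ _).mpr h'))]
      | succ j =>
        rw [List.replicate_succ, List.replicate_succ, MZV.shuffleWord_cons_cons, List.count_append,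
          count_cons_map_cons, count_cons_map_cons, ← List.replicate_succ, ← List.replicate_succ,
          ih i (j + 1), ih (i + 1) j]
        cases c
        · simp only [if_true, List.count_cons_self, Bool.false_eq_true, if_false, add_zero]
          rw [List.count_cons_of_ne (by decide)]
          by_cases h : w.count false = i ∧ w.count true = j + 1
          · rw [if_pos h, if_pos ⟨by omega, h.2⟩]
          · rw [if_neg h, if_neg (fun h' => h ⟨by omega, h'.2⟩)]
        · simp only [if_true, List.count_cons_self, Bool.true_eq_false, if_false, zero_add]
          rw [List.count_cons_of_ne (by decide)]
          by_cases h : w.count false = i + 1 ∧ w.count true = j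
          · rw [if_pos h, if_pos ⟨h.1, by omega⟩]
          · rw [if_neg h, if_neg (fun h' => h ⟨h'.1, by omega⟩)]

end CountingBool

section GroupLikeDegenerate

/-- **Sum of the coefficients of a group-like series over all words with `i` zeros and `j` ones**:
it is `c_{0ⁱ}(φ) c_{1ʲ}(φ)` — the shuffle relation for `0ⁱ ш 1ʲ`. [folklore] -/
theorem IsGroupLike.sum_filter_count_eq [Semiring R] {φ : NCSeries Bool R} (hg : IsGroupLike φ)
    (N i j : ℕ) :
    ∑ w ∈ (wordsLE Bool N).filter (fun w => (w.count false, w.count true) = (i, j)), φ w =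
      if i + j ≤ N then φ (List.replicate i false) * φ (List.replicate j true) else 0 := by
  split_ifs with hij
  · have hnodup : (MZV.shuffleWord (List.replicate i false) (List.replicate j true)).Nodup :=
      List.nodup_iff_count_le_one.mpr fun w => by
        rw [count_shuffleWord_replicate]; split_ifs <;> omega
    have hset : (MZV.shuffleWord (List.replicate i false) (List.replicate j true)).toFinset =
        (wordsLE Bool N).filter (fun w => (w.count false, w.count true) = (i, j)) := by
      ext w
      rw [List.mem_toFinset, Finset.mem_filter, mem_wordsLE, ← List.count_pos_iff,
        count_shuffleWord_replicate, Prod.mk.injEq]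
      constructor
      · intro h
        by_cases hw : w.count false = i ∧ w.count true = j
        · refine ⟨?_, hw⟩
          have : w.count false + w.count true = w.length := List.count_not_add_count w true
          omega
        · rw [if_neg hw] at h
          exact absurd h (lt_irrefl 0)
      · rintro ⟨-, hw⟩
        rw [if_pos hw]
        exact Nat.one_pos
    rw [hg.2, ← List.sum_toFinset _ hnodup, hset]
  · refine Finset.sum_eq_zero fun w hw => ?_
    exfalso
    rw [Finset.mem_filter, mem_wordsLE, Prod.mk.injEq] at hw
    have : w.count false + w.count true = w.length := List.count_not_add_count w true
    omega

/-- For a group-like series over a `ℚ`-algebra, `c_a(φ) = 0` forces `c_{aⁿ}(φ) = 0` for all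
`n ≥ 1` (`c_a c_{aⁿ⁻¹} = n c_{aⁿ}`). [folklore] -/
theorem IsGroupLike.apply_replicate_eq_zero {R : Type v} [Ring R] [Algebra ℚ R] [DecidableEq α]
    {φ : NCSeries α R} (hg : IsGroupLike φ) {a : α} (ha : φ [a] = 0) :
    ∀ n : ℕ, n ≠ 0 → φ (List.replicate n a) = 0 := by
  intro n hn
  obtain ⟨m, rfl⟩ := Nat.exists_eq_succ_of_ne_zero hn
  have h := hg.2 [a] (List.replicate m a)
  rw [ha, zero_mul, shuffleWord_singleton_replicate, List.map_replicate, List.sum_replicate] at h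
  have h' : ((m + 1 : ℕ) : ℚ) • φ (List.replicate (m + 1) a) = 0 := by
    rw [Nat.cast_smul_eq_nsmul]; exact h.symm
  have hne : ((m + 1 : ℕ) : ℚ) ≠ 0 := Nat.cast_ne_zero.mpr (Nat.succ_ne_zero m)
  calc φ (List.replicate (m + 1) a)
      = ((m + 1 : ℕ) : ℚ)⁻¹ • (((m + 1 : ℕ) : ℚ) • φ (List.replicate (m + 1) a)) := by
        rw [smul_smul, inv_mul_cancel₀ hne, one_smul]
    _ = 0 := by rw [h', smul_zero]

/-- Products of commuting elements substituted into a binary word sort into `A^{#0} B^{#1}`.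
[folklore] -/
theorem prod_map_bsub_of_commute {A : Type*} [Monoid A] {a b : A} (hab : Commute a b) :
    ∀ w : List Bool, (w.map (bsub a b)).prod = a ^ w.count false * b ^ w.count true
  | [] => by simp
  | false :: w => by
    rw [List.map_cons, List.prod_cons, prod_map_bsub_of_commute hab w, bsub_false,
      List.count_cons_self, List.count_cons_of_ne (by decide), pow_succ', mul_assoc]
  | true :: w => by
    rw [List.map_cons, List.prod_cons, prod_map_bsub_of_commute hab w, bsub_true,
      List.count_cons_self, List.count_cons_of_ne (by decide), pow_succ', ← mul_assoc,
      ← (hab.pow_left _).eq, mul_assoc]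

/-- **Degenerate evaluations of commutator-group-like series**: if `φ` is group-like with
`c_X(φ) = c_Y(φ) = 0` (over a `ℚ`-algebra) and `A B = B A`, then `φ(A, B) = 1` in every
weight truncation — the substitution factors through the abelianisation `φ^{ab} = exp(αX + βY)`
with `α = β = 0` [Furusho2010, proof of Lemma 5]. [cite: Furusho2010, Lemma 5] -/
theorem IsGroupLike.evalTrunc_eq_one_of_commute {R : Type v} [CommRing R] [Algebra ℚ R]
    {A : Type*} [Ring A] [Algebra R A] {φ : NCSeries Bool R} (hg : IsGroupLike φ)
    (h0 : φ [false] = 0) (h1 : φ [true] = 0) (N : ℕ) {a b : A} (hab : Commute a b) :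
    evalTrunc N (bsub a b) φ = 1 := by
  rw [evalTrunc_eq_sum_wordsLE]
  simp_rw [prod_map_bsub_of_commute hab]
  rw [← Finset.sum_fiberwise_of_maps_to (s := wordsLE Bool N)
    (t := Finset.range (N + 1) ×ˢ Finset.range (N + 1))
    (g := fun w : List Bool => (w.count false, w.count true)) (fun w hw => ?_)]
  · rw [Finset.sum_eq_single_of_mem ((0 : ℕ), (0 : ℕ)) (by simp) ?_]
    · have hc : ∀ w ∈ (wordsLE Bool N).filter (fun w => (w.count false, w.count true) = (0, 0)),
          φ w • (a ^ w.count false * b ^ w.count true) = φ w • (1 : A) := by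
        intro w hw
        rw [Finset.mem_filter, Prod.mk.injEq] at hw
        rw [hw.2.1, hw.2.2, pow_zero, pow_zero, mul_one]
      rw [Finset.sum_congr rfl hc, ← Finset.sum_smul, hg.sum_filter_count_eq N 0 0,
        if_pos (Nat.zero_le _)]
      simp [hg.1]
    · rintro ⟨i, j⟩ - hne
      have hc : ∀ w ∈ (wordsLE Bool N).filter (fun w => (w.count false, w.count true) = (i, j)),
          φ w • (a ^ w.count false * b ^ w.count true) = φ w • (a ^ i * b ^ j) := by
        intro w hw
        rw [Finset.mem_filter, Prod.mk.injEq] at hw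
        rw [hw.2.1, hw.2.2]
      rw [Finset.sum_congr rfl hc, ← Finset.sum_smul, hg.sum_filter_count_eq N i j]
      split_ifs with hij
      · rcases Nat.eq_zero_or_pos i with hi | hi
        · subst hi
          have hj : j ≠ 0 := by rintro rfl; exact hne rfl
          rw [hg.apply_replicate_eq_zero h1 j hj, mul_zero, zero_smul]
        · rw [hg.apply_replicate_eq_zero h0 i (by omega), zero_mul, zero_smul]
      · exact zero_smul _ _
  · simp only [Finset.mem_product, Finset.mem_range]
    rw [mem_wordsLE] at hw
    have : w.count false + w.count true = w.length := List.count_not_add_count w true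
    constructor <;> omega

end GroupLikeDegenerate

/-! ## 6. The 2-cycle relation [Furusho2010, Lemma 6] -/

section TwoCycle

/-- Coefficients of a finite sum of series. [folklore] -/
theorem finset_sum_apply [Semiring R] {ι : Type*} (s : Finset ι) (g : ι → NCSeries α R)
    (w : List α) : (∑ i ∈ s, g i) w = ∑ i ∈ s, g i w := by
  rw [← coeff_apply w (∑ i ∈ s, g i), map_sum]
  rfl

/-- `monomial [] 1 = 1`. [folklore] -/
@[simp] theorem monomial_nil_one [Semiring R] [DecidableEq α] :
    (monomial [] 1 : NCSeries α R) = 1 := by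
  ext w
  rw [monomial_apply]
  cases w <;> simp

/-- A product of letters is the monomial of the word. [folklore] -/
theorem prod_map_letter [Semiring R] [DecidableEq α] (σ : α → α) : ∀ u : List α,
    (u.map fun a => (letter (σ a) : NCSeries α R)).prod = monomial (u.map σ) 1
  | [] => by simp
  | a :: u => by
    rw [List.map_cons, List.prod_cons, prod_map_letter σ u]
    show monomial [σ a] 1 * monomial (u.map σ) 1 = _
    rw [monomial_mul_monomial, one_mul]
    rfl

/-- **Substituting permuted letters**: `φ(X_{σ a})` truncated at weight `N` has coefficient
`c_{σ⁻¹ w}(φ)` at `w` for `|w| ≤ N` (and `0` beyond). [folklore] -/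
theorem evalTrunc_letter_perm_apply [CommSemiring R] [Fintype α] [DecidableEq α] (σ : α ≃ α)
    (N : ℕ) (φ : NCSeries α R) (w : List α) :
    evalTrunc N (fun a => (letter (σ a) : NCSeries α R)) φ w =
      if w.length ≤ N then φ (w.map σ.symm) else 0 := by
  rw [evalTrunc_eq_sum_wordsLE]
  simp_rw [prod_map_letter]
  rw [finset_sum_apply]
  simp_rw [smul_apply, monomial_apply, smul_eq_mul, mul_ite, mul_one, mul_zero]
  split_ifs with hw
  · rw [Finset.sum_eq_single_of_mem (w.map σ.symm) (by simpa using hw) ?_]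
    · rw [if_pos]
      simp [List.map_map]
    · intro u _ hu
      rw [if_neg]
      rintro rfl
      exact hu (by simp [List.map_map])
  · refine Finset.sum_eq_zero fun u hu => ?_
    rw [if_neg]
    rintro rfl
    rw [mem_wordsLE] at hu
    rw [List.length_map] at hw
    exact hw hu

variable {R : Type v}

/-- `φ(Y, X)`: the series with the two letters exchanged, `c_w(φ(Y,X)) = c_{w̄}(φ)` where `w̄`
negates every letter. [cite: Furusho2010, Lemma 6] -/
def swapXY (φ : NCSeries Bool R) : NCSeries Bool R := fun w => φ (w.map not)

/-- `c_w(φ(Y,X)) = c_{w̄}(φ)`. [folklore] -/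
@[simp] theorem swapXY_apply (φ : NCSeries Bool R) (w : List Bool) : swapXY φ w = φ (w.map not) :=
  rfl

variable {k : Type u} [CommRing k]

/-- `φ(X, Y) ≡ φ` in every truncation. [folklore] -/
theorem mk_evalTrunc_X₀_X₁ (N : ℕ) (φ : NCSeries Bool k) :
    Ideal.Quotient.mk (truncIdeal Bool k N) (evalTrunc N (bsub X₀ X₁) φ) =
      Ideal.Quotient.mk (truncIdeal Bool k N) φ := by
  rw [mk_eq_mk_iff]
  intro w hw
  rw [show (bsub X₀ X₁ : Bool → NCSeries Bool k) = fun a => letter ((Equiv.refl Bool) a) from by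
    funext c; cases c <;> rfl, evalTrunc_letter_perm_apply, if_pos hw]
  simp

/-- `φ(Y, X) ≡ swapXY φ` in every truncation. [folklore] -/
theorem mk_evalTrunc_X₁_X₀ (N : ℕ) (φ : NCSeries Bool k) :
    Ideal.Quotient.mk (truncIdeal Bool k N) (evalTrunc N (bsub X₁ X₀) φ) =
      Ideal.Quotient.mk (truncIdeal Bool k N) (swapXY φ) := by
  rw [mk_eq_mk_iff]
  intro w hw
  rw [show (bsub X₁ X₀ : Bool → NCSeries Bool k) = fun a => letter (Equiv.boolNot a) from by
    funext c; cases c <;> rfl, evalTrunc_letter_perm_apply, if_pos hw]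
  rfl

variable [Algebra ℚ k]

/-- Degenerate evaluations in the truncated free algebra: `[φ(A, B)] = 1` for commuting
`A, B ∈ k⟨⟨X,Y⟩⟩` and commutator-group-like `φ`. [folklore] -/
theorem IsGroupLike.mk_evalTrunc_eq_one {φ : NCSeries Bool k} (hg : IsGroupLike φ)
    (h0 : φ [false] = 0) (h1 : φ [true] = 0) (N : ℕ) {A B : NCSeries Bool k} (hAB : Commute A B) :
    Ideal.Quotient.mk (truncIdeal Bool k N) (evalTrunc N (bsub A B) φ) = 1 := by
  rw [mk_evalTrunc]
  exact hg.evalTrunc_eq_one_of_commute h0 h1 N (hAB.map (Ideal.Quotient.mk (truncIdeal Bool k N)))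

/-- **The 2-cycle relation** [Furusho2010, Lemma 6]: a group-like solution `φ ∈ k⟨⟨X,Y⟩⟩` of
Drinfeld's pentagon equation (`k` a commutative `ℚ`-algebra) satisfies
`φ(X,Y) φ(Y,X) = 1 = φ(Y,X) φ(X,Y)`. Proof as printed: the pentagon forces
`c_X(φ) = c_Y(φ) = 0` (`DrinfeldPentagon.apply_letter_eq_zero`), and its image under the
projection `q` (`DrinfeldPentagon.projQ_pentagon`) reads `φ(X,-X) φ(-X,X) = φ(Y,X) φ(-Y,-Y) φ(X,Y)`
with all degenerate factors equal to `1`. [cite: Furusho2010, Lemma 6] -/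
theorem DrinfeldPentagon.two_cycle {φ : NCSeries Bool k} (h : DrinfeldPentagon φ)
    (hg : IsGroupLike φ) : φ * swapXY φ = 1 ∧ swapXY φ * φ = 1 := by
  have h0 : φ [false] = 0 := h.apply_letter_eq_zero_of_isGroupLike hg false
  have h1 : φ [true] = 0 := h.apply_letter_eq_zero_of_isGroupLike hg true
  have hX₀ : (X₀ : NCSeries Bool k) [] = 0 := by simp
  have hX₁ : (X₁ : NCSeries Bool k) [] = 0 := by simp
  constructor
  · ext w
    have hp := h.projQ_pentagon w.length X₁ X₀ hX₁ hX₀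
    rw [hg.mk_evalTrunc_eq_one h0 h1 _ (Commute.neg_right (Commute.refl _)),
      hg.mk_evalTrunc_eq_one h0 h1 _ (Commute.neg_left (Commute.refl _)),
      hg.mk_evalTrunc_eq_one h0 h1 _ (Commute.refl _), mk_evalTrunc_X₀_X₁, mk_evalTrunc_X₁_X₀,
      one_mul, mul_one, ← map_mul, eq_comm, ← map_one (Ideal.Quotient.mk (truncIdeal Bool k _)),
      mk_eq_mk_iff] at hp
    exact hp w le_rfl
  · ext w
    have hp := h.projQ_pentagon w.length X₀ X₁ hX₀ hX₁
    rw [hg.mk_evalTrunc_eq_one h0 h1 _ (Commute.neg_right (Commute.refl _)),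
      hg.mk_evalTrunc_eq_one h0 h1 _ (Commute.neg_left (Commute.refl _)),
      hg.mk_evalTrunc_eq_one h0 h1 _ (Commute.refl _), mk_evalTrunc_X₀_X₁, mk_evalTrunc_X₁_X₀,
      one_mul, mul_one, ← map_mul, eq_comm, ← map_one (Ideal.Quotient.mk (truncIdeal Bool k _)),
      mk_eq_mk_iff] at hp
    exact hp w le_rfl

end TwoCycle

end NCSeries

end Literature.NumberTheory.Transcendental
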